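import Mathlib
import Summits.Ventures.PercRepro2.TriExchangeable

/-!
# The typed crux 2′TRI in measure language: product couplings of three copies
(blind cell PercRepro2, typer-1 g15, 2026-08-26)

`TriExchangeable.lean` reads row 2′TRI (`CovForm.TypedBases`) as «`K₃` has nonnegative expectation
under every edge-wise product coupling of three copies with exchangeable edge laws», the edge laws
being nonnegative functions on `Bool × Bool × Bool`.  This file says the same thing with Mathlib's
measures: a coupling of three copies of the percolation process that is a product over the edges
is `Measure.pi ν` for edge measures `ν e` on the three states `Bool × Bool × Bool` of an edge, and
`ν e` is exchangeable when it is invariant under the two transpositions `swap12`, `swap23` of the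
copies (`(ν e).map swap12 = ν e`, `(ν e).map swap23 = ν e`).

* `law m a b c = m.real {(a, b, c)}` is the edge law of a measure; `integral_pi_eq_exchExpect`:
  `∫ ξ, K (ξ₁) (ξ₂) (ξ₃) ∂(Measure.pi ν) = exchExpect (fun e => law (ν e)) K` for finite `ν e`;
* `lawMeasure l` is the measure with edge law `l` (a combination of Dirac masses); the typed laws
  give probability measures (`lawMeasure_nu_isProbabilityMeasure`);
* **`typedBases_iff_measure`** : `TypedBases (R := ℝ) … ↔ ∀ ν finite, exchangeable,
  0 ≤ ∫ ξ, K₃ (ξ₁) (ξ₂) (ξ₃) ∂(Measure.pi ν)`, and **`typedBases_iff_probabilityMeasure`** with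
  probability measures — row 2′TRI holds iff `E[K₃(X, Y, Z)] ≥ 0` for every triple of copies
  `(X, Y, Z)` whose joint law is a product over the edges of exchangeable laws.

Own work; standard axioms.
-/

namespace Summit.Ventures.PercRepro2

namespace TriExchange

open MeasureTheory
open scoped ENNReal

/-! ## The three copies of an edge state -/

section States

/-- Swapping the first two copies of an edge state. -/
def swap12 (t : Bool × Bool × Bool) : Bool × Bool × Bool := (t.2.1, t.1, t.2.2)

/-- Swapping the last two copies of an edge state. -/
def swap23 (t : Bool × Bool × Bool) : Bool × Bool × Bool := (t.1, t.2.2, t.2.1)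

/-- The preimage of a point under `swap12` (an involution). -/
lemma preimage_swap12_singleton (t : Bool × Bool × Bool) : swap12 ⁻¹' {t} = {swap12 t} := by
  obtain ⟨a, b, c⟩ := t
  ext ⟨x, y, z⟩
  simp only [Set.mem_preimage, Set.mem_singleton_iff, swap12, Prod.mk.injEq]
  tauto

/-- The preimage of a point under `swap23` (an involution). -/
lemma preimage_swap23_singleton (t : Bool × Bool × Bool) : swap23 ⁻¹' {t} = {swap23 t} := by
  obtain ⟨a, b, c⟩ := t
  ext ⟨x, y, z⟩
  simp only [Set.mem_preimage, Set.mem_singleton_iff, swap23, Prod.mk.injEq]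
  tauto

/-- The edge law of a measure on the three states of an edge: the masses of the points. -/
noncomputable def law (m : Measure (Bool × Bool × Bool)) (a b c : Bool) : ℝ := m.real {(a, b, c)}

/-- Edge laws of measures are nonnegative. -/
lemma law_nonneg (m : Measure (Bool × Bool × Bool)) (a b c : Bool) : 0 ≤ law m a b c :=
  measureReal_nonneg

/-- The point masses of a measure invariant under `swap12`. -/
lemma apply_singleton_swap12 {m : Measure (Bool × Bool × Bool)} (h : m.map swap12 = m)
    (t : Bool × Bool × Bool) : m {swap12 t} = m {t} := by
  conv_rhs => rw [← h]
  rw [Measure.map_apply (measurable_of_countable _) (measurableSet_singleton _),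
    preimage_swap12_singleton]

/-- The point masses of a measure invariant under `swap23`. -/
lemma apply_singleton_swap23 {m : Measure (Bool × Bool × Bool)} (h : m.map swap23 = m)
    (t : Bool × Bool × Bool) : m {swap23 t} = m {t} := by
  conv_rhs => rw [← h]
  rw [Measure.map_apply (measurable_of_countable _) (measurableSet_singleton _),
    preimage_swap23_singleton]

/-- **The edge law of an exchangeable measure is exchangeable.** -/
lemma law_isExchangeable {m : Measure (Bool × Bool × Bool)} (h12 : m.map swap12 = m)
    (h23 : m.map swap23 = m) : IsExchangeable (law m) := by
  intro a b c
  constructor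
  · show m.real {(a, b, c)} = m.real {(b, a, c)}
    rw [measureReal_def, measureReal_def, ← apply_singleton_swap12 h12 (a, b, c)]
    rfl
  · show m.real {(a, b, c)} = m.real {(a, c, b)}
    rw [measureReal_def, measureReal_def, ← apply_singleton_swap23 h23 (a, b, c)]
    rfl

end States

/-! ## Product couplings and the expectation of a three-copy kernel -/

section Coupling

variable {E : Type*} [Fintype E] [DecidableEq E]

/-- The first copy of a three-copy state. -/
def tri₁ (ξ : E → Bool × Bool × Bool) : Config E := fun e => (ξ e).1

/-- The second copy of a three-copy state. -/
def tri₂ (ξ : E → Bool × Bool × Bool) : Config E := fun e => (ξ e).2.1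

/-- The third copy of a three-copy state. -/
def tri₃ (ξ : E → Bool × Bool × Bool) : Config E := fun e => (ξ e).2.2

/-- Three-copy states are triples of configurations. -/
def tripleEquiv : (E → Bool × Bool × Bool) ≃ Config E × Config E × Config E where
  toFun ξ := (tri₁ ξ, tri₂ ξ, tri₃ ξ)
  invFun t := fun e => (t.1 e, t.2.1 e, t.2.2 e)
  left_inv _ := rfl
  right_inv _ := rfl

/-- A sum over three-copy states is a triple sum over configurations. -/
lemma sum_triple (g : Config E → Config E → Config E → ℝ) :
    ∑ ξ : E → Bool × Bool × Bool, g (tri₁ ξ) (tri₂ ξ) (tri₃ ξ) = ∑ x, ∑ y, ∑ w, g x y w := by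
  rw [Fintype.sum_equiv tripleEquiv (fun ξ => g (tri₁ ξ) (tri₂ ξ) (tri₃ ξ))
    (fun t => g t.1 t.2.1 t.2.2) (fun _ => rfl), Fintype.sum_prod_type]
  simp_rw [Fintype.sum_prod_type]

/-- **The expectation of a three-copy kernel under a product coupling** is the finite-sum
expectation `exchExpect` under the edge laws of the factors. -/
theorem integral_pi_eq_exchExpect (ν : E → Measure (Bool × Bool × Bool))
    [∀ e, IsFiniteMeasure (ν e)] (K : Config E → Config E → Config E → ℝ) :
    ∫ ξ, K (tri₁ ξ) (tri₂ ξ) (tri₃ ξ) ∂(Measure.pi ν) = exchExpect (fun e => law (ν e)) K := by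
  rw [integral_fintype Integrable.of_finite, exchExpect,
    ← sum_triple (fun x y w => (∏ e, law (ν e) (x e) (y e) (w e)) * K x y w)]
  refine Finset.sum_congr rfl fun ξ _ => ?_
  rw [smul_eq_mul, measureReal_def, Measure.pi_singleton, ENNReal.toReal_prod]
  rfl

end Coupling

/-! ## Measures with a prescribed edge law -/

section LawMeasure

/-- The measure on the three states of an edge with edge law `l` (a combination of Dirac masses;
negative values of `l` are truncated to `0`). -/
noncomputable def lawMeasure (l : Bool → Bool → Bool → ℝ) : Measure (Bool × Bool × Bool) :=
  ∑ t : Bool × Bool × Bool, ENNReal.ofReal (l t.1 t.2.1 t.2.2) • Measure.dirac t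

/-- `lawMeasure l` is a finite measure (a lemma, not an instance: the typed laws below are
registered as probability measures where needed). -/
lemma lawMeasure_isFiniteMeasure (l : Bool → Bool → Bool → ℝ) :
    IsFiniteMeasure (lawMeasure l) := by
  unfold lawMeasure
  haveI : ∀ t : Bool × Bool × Bool,
      IsFiniteMeasure (ENNReal.ofReal (l t.1 t.2.1 t.2.2) • Measure.dirac t) :=
    fun t => Measure.smul_finite _ ENNReal.ofReal_ne_top
  infer_instance

/-- The point masses of `lawMeasure l`. -/
lemma lawMeasure_singleton (l : Bool → Bool → Bool → ℝ) (t : Bool × Bool × Bool) :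
    lawMeasure l {t} = ENNReal.ofReal (l t.1 t.2.1 t.2.2) := by
  unfold lawMeasure
  rw [Measure.finsetSum_apply]
  simp only [Measure.smul_apply, Measure.dirac_apply, smul_eq_mul, Set.indicator_apply,
    Set.mem_singleton_iff, Pi.one_apply, mul_ite, mul_one, mul_zero, Finset.sum_ite_eq',
    Finset.mem_univ, if_true]

/-- The total mass of `lawMeasure l`. -/
lemma lawMeasure_univ (l : Bool → Bool → Bool → ℝ) :
    lawMeasure l Set.univ = ∑ t : Bool × Bool × Bool, ENNReal.ofReal (l t.1 t.2.1 t.2.2) := by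
  unfold lawMeasure
  rw [Measure.finsetSum_apply]
  simp only [Measure.smul_apply, Measure.dirac_apply, smul_eq_mul, Set.indicator_univ,
    Pi.one_apply, mul_one]

/-- The edge law of `lawMeasure l` is `l` when `l` is nonnegative. -/
lemma law_lawMeasure {l : Bool → Bool → Bool → ℝ} (hl : ∀ a b c, 0 ≤ l a b c) :
    law (lawMeasure l) = l := by
  funext a b c
  show (lawMeasure l).real {(a, b, c)} = l a b c
  rw [measureReal_def, lawMeasure_singleton, ENNReal.toReal_ofReal (hl a b c)]

/-- `lawMeasure` of an exchangeable law is invariant under `swap12`. -/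
lemma map_swap12_lawMeasure {l : Bool → Bool → Bool → ℝ} (hl : IsExchangeable l) :
    (lawMeasure l).map swap12 = lawMeasure l := by
  refine Measure.ext_of_singleton fun t => ?_
  rw [Measure.map_apply (measurable_of_countable _) (measurableSet_singleton _),
    preimage_swap12_singleton, lawMeasure_singleton, lawMeasure_singleton]
  obtain ⟨a, b, c⟩ := t
  show ENNReal.ofReal (l b a c) = ENNReal.ofReal (l a b c)
  rw [(hl a b c).1]

/-- `lawMeasure` of an exchangeable law is invariant under `swap23`. -/
lemma map_swap23_lawMeasure {l : Bool → Bool → Bool → ℝ} (hl : IsExchangeable l) :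
    (lawMeasure l).map swap23 = lawMeasure l := by
  refine Measure.ext_of_singleton fun t => ?_
  rw [Measure.map_apply (measurable_of_countable _) (measurableSet_singleton _),
    preimage_swap23_singleton, lawMeasure_singleton, lawMeasure_singleton]
  obtain ⟨a, b, c⟩ := t
  show ENNReal.ofReal (l a c b) = ENNReal.ofReal (l a b c)
  rw [(hl a b c).2]

/-- The typed law `nu k` has total mass `1` for `k ≤ 3`. -/
lemma sum_nu (k : ℕ) (hk : k ≤ 3) :
    ∑ t : Bool × Bool × Bool, nu (R := ℝ) k t.1 t.2.1 t.2.2 = 1 := by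
  have h0 : Nat.choose 3 0 = 1 := by decide
  have h1 : Nat.choose 3 1 = 3 := by decide
  have h2 : Nat.choose 3 2 = 3 := by decide
  have h3 : Nat.choose 3 3 = 1 := by decide
  interval_cases k <;>
    simp only [Fintype.sum_prod_type, Fintype.sum_bool, nu, cnt, Bool.toNat_true,
      Bool.toNat_false] <;>
    norm_num [h0, h1, h2, h3]

/-- **The typed laws give probability measures** (`k ≤ 3`). -/
lemma lawMeasure_nu_isProbabilityMeasure (k : ℕ) (hk : k ≤ 3) :
    IsProbabilityMeasure (lawMeasure (nu (R := ℝ) k)) := by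
  refine ⟨?_⟩
  rw [lawMeasure_univ, ← ENNReal.ofReal_sum_of_nonneg (fun t _ => nu_nonneg k _ _ _), sum_nu k hk,
    ENNReal.ofReal_one]

end LawMeasure

/-! ## The crux -/

section Crux

variable {V : Type*} {E : Type*} [Fintype E] [DecidableEq E]

/-- The cubic kernel `K₃` (real-valued) evaluated on a three-copy state. -/
noncomputable def K3tri (ends : E → Sym2 V) (o a₁ a₂ a₃ b : V) (ξ : E → Bool × Bool × Bool) : ℝ :=
  CovForm.K3 ends o a₁ a₂ a₃ b (tri₁ ξ) (tri₂ ξ) (tri₃ ξ)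

/-- The integral of `K3tri` under a product coupling is the finite-sum expectation of `K₃`. -/
lemma integral_K3tri (ends : E → Sym2 V) (o a₁ a₂ a₃ b : V) (ν : E → Measure (Bool × Bool × Bool))
    [∀ e, IsFiniteMeasure (ν e)] :
    ∫ ξ, K3tri ends o a₁ a₂ a₃ b ξ ∂(Measure.pi ν) =
      exchExpect (fun e => law (ν e)) (CovForm.K3 ends o a₁ a₂ a₃ b) :=
  integral_pi_eq_exchExpect ν (CovForm.K3 ends o a₁ a₂ a₃ b)

/-- **Row 2′TRI from the typed couplings alone**: if `K₃` has nonnegative expectation under every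
product of typed laws `nu (τ e)`, `τ ≤ 3`, then the typed bases are nonnegative. -/
theorem typedBases_of_typed (ends : E → Sym2 V) (o a₁ a₂ a₃ b : V)
    (h : ∀ τ : E → ℕ, (∀ e, τ e ≤ 3) →
      0 ≤ exchExpect (fun e => nu (τ e)) (CovForm.K3 ends o a₁ a₂ a₃ b : Config E → Config E → Config E → ℝ)) :
    CovForm.TypedBases (R := ℝ) ends o a₁ a₂ a₃ b := by
  intro F z τ hτ
  have h3 := extend_le_three (z := z) hτ
  have key := h _ h3
  rw [exchExpect_nu_eq_typedCount (extend F z τ) h3, typedSet_extend hτ, typedCount_extend,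
    mul_nonneg_iff_of_pos_left (prod_inv_choose_pos _ h3)] at key
  exact key

/-- **Row 2′TRI from exchangeable product probability couplings**: if `E[K₃(X, Y, Z)] ≥ 0` for every
triple of copies whose joint law is a product over the edges of exchangeable probability measures,
then the typed bases are nonnegative. -/
theorem typedBases_of_probabilityMeasure (ends : E → Sym2 V) (o a₁ a₂ a₃ b : V)
    (h : ∀ (ν : E → Measure (Bool × Bool × Bool)) [∀ e, IsProbabilityMeasure (ν e)],
      (∀ e, (ν e).map swap12 = ν e) → (∀ e, (ν e).map swap23 = ν e) →
      0 ≤ ∫ ξ, K3tri ends o a₁ a₂ a₃ b ξ ∂(Measure.pi ν)) :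
    CovForm.TypedBases (R := ℝ) ends o a₁ a₂ a₃ b := by
  refine typedBases_of_typed ends o a₁ a₂ a₃ b fun τ hτ => ?_
  haveI : ∀ e, IsProbabilityMeasure (lawMeasure (nu (R := ℝ) (τ e))) :=
    fun e => lawMeasure_nu_isProbabilityMeasure (τ e) (hτ e)
  have key := h (fun e => lawMeasure (nu (τ e))) (fun e => map_swap12_lawMeasure (nu_isExchangeable _))
    (fun e => map_swap23_lawMeasure (nu_isExchangeable _))
  rw [integral_K3tri] at key
  have hlaw : (fun e => law (lawMeasure (nu (R := ℝ) (τ e)))) = fun e => nu (τ e) :=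
    funext fun e => law_lawMeasure (nu_nonneg (τ e))
  rwa [hlaw] at key

/-- **Row 2′TRI in measure language** — the typed bases of `K₃` are nonnegative iff `K₃` has
nonnegative integral under every product over the edges of finite exchangeable measures on the
three states of an edge. -/
theorem typedBases_iff_measure (ends : E → Sym2 V) (o a₁ a₂ a₃ b : V) :
    CovForm.TypedBases (R := ℝ) ends o a₁ a₂ a₃ b ↔
      ∀ (ν : E → Measure (Bool × Bool × Bool)) [∀ e, IsFiniteMeasure (ν e)],
        (∀ e, (ν e).map swap12 = ν e) → (∀ e, (ν e).map swap23 = ν e) →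
        0 ≤ ∫ ξ, K3tri ends o a₁ a₂ a₃ b ξ ∂(Measure.pi ν) := by
  constructor
  · intro h ν _ h12 h23
    rw [integral_K3tri]
    exact (typedBases_iff_exchangeable ends o a₁ a₂ a₃ b).1 h _
      (fun e a b c => law_nonneg _ _ _ _) (fun e => law_isExchangeable (h12 e) (h23 e))
  · intro h
    exact typedBases_of_probabilityMeasure ends o a₁ a₂ a₃ b fun ν _ h12 h23 => h ν h12 h23

/-- **Row 2′TRI as a statement about couplings of three copies**: the typed bases of `K₃` are
nonnegative iff `E[K₃(X, Y, Z)] ≥ 0` for every triple of copies `(X, Y, Z)` of the bond process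
whose joint law is a product over the edges of exchangeable probability measures on the three
states of an edge. -/
theorem typedBases_iff_probabilityMeasure (ends : E → Sym2 V) (o a₁ a₂ a₃ b : V) :
    CovForm.TypedBases (R := ℝ) ends o a₁ a₂ a₃ b ↔
      ∀ (ν : E → Measure (Bool × Bool × Bool)) [∀ e, IsProbabilityMeasure (ν e)],
        (∀ e, (ν e).map swap12 = ν e) → (∀ e, (ν e).map swap23 = ν e) →
        0 ≤ ∫ ξ, K3tri ends o a₁ a₂ a₃ b ξ ∂(Measure.pi ν) := by
  constructor
  · intro h ν _ h12 h23
    exact (typedBases_iff_measure ends o a₁ a₂ a₃ b).1 h ν h12 h23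
  · exact typedBases_of_probabilityMeasure ends o a₁ a₂ a₃ b

end Crux

end TriExchange

end Summit.Ventures.PercRepro2
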